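import Mathlib
import HarnessLib
import Summits.NavierStokesRegularity.NavierStokesRegularity.Theorems.UnthreadedRigidityDoorUnthreadedRigidityTwoShellQuarticLaw

/-!
# Route `UnthreadedRigidityDoor`, item `UnthreadedRigidity` (W2, stmt-NavierStokesRegularity-27585) — LINE g12-1 «CO-ZONAL» / g12-2 «PERSISTENCE»:
# THE POWER-LAW NONEXISTENCE IN EVERY DEGREE, MODULO ONE DECAY INPUT — `b_L ≡ 0 ⇒ K·H` keeps a constant sign; `+ |H| = O(r^{−(3L+1)}) ⇒ H ≡ 0`

Prover file (engine-1 g74; `--supports stmt-NavierStokesRegularity-27585 --as helper`; route-independent imports).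

The order argument of `…TwoShellQuarticLaw` (L = 3) is DEGREE-UNIFORM: for an admissible analytic profile of degree `L = m + 2` with `b_L[H] ≡ 0`
and `H ≢ 0`, the power law `K^{L+1} = C·H^{L−1}` (`powerLaw`) has `C ≠ 0` unless `K ≡ 0`; the zeros of `K` and `H` on `(0,∞)` then coincide, and at
a common zero with `ord H = h`, `ord K = k` one has `(L+1)k = (L−1)h` (law) and `k = h − 2` (`K = H″ + 2(L+1)H′/r`), whence `(h,k) = (L+1, L−1)`
and `ord(K·H) = 2L` is EVEN; off the zeros the order is `0`.  So `K·H` keeps a constant sign (`constant_sign_of_even_order`):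
* ★ `constant_sign_of_bL_eq_zero` — `b_{m+2}[H] ≡ 0 ⇒ (K·H ≥ 0 on (0,∞)) ∨ (K·H ≤ 0 on (0,∞))`, every degree;
* ★ `eq_zero_of_bL_eq_zero_of_decay` — `b_{m+2}[H] ≡ 0` and `|H| ≤ D·r^{−(3(m+2)+1)}` on `[1,∞)` ⇒ `H ≡ 0` on `(0,∞)`, every degree (the two landed
  branches `eq_zero_of_bL_eq_zero_of_nonneg` p733521 / `eq_zero_of_bL_eq_zero_of_nonpos_of_decay` p734108).
THE ONE OPEN INPUT for every consecutive two-shell window rung `(l, l+1)` with top degree `L ≥ 5` is therefore the decay `|H| = O(r^{−(3L+1)})` of a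
profile with `b_L ≡ 0` and `K·H ≤ 0` (for `L ≤ 4` the bootstrap `|H| = (|K|^{L+1}/|C|)^{1/(L−1)}` supplies it: files `…QuinticLaw`, `…QuarticLaw`).

HONEST LABEL: elementary ODE / analytic-order lemmas (support of a rung line); nothing here bears on `UnthreadedRigidity` (27585), the door Target, W2 or
Navier–Stokes regularity; no summit statement is proved.  MODEL/rung work; 0 kit.  [folklore]
-/

noncomputable section

-- the summit and its single sub-problem share the name (CONVENTIONS §1), as in every Theorems file
set_option linter.dupNamespace false

namespace Summit.NavierStokesRegularity.NavierStokesRegularity.Theorems.UnthreadedRigidity.MixedPair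

open Set Function Filter Topology
open Summit.NavierStokesRegularity.NavierStokesRegularity.Theorems.UnthreadedRigidity.VirialHorn (VirialAdmissible vortAmpL strainAmpL)
open Summit.NavierStokesRegularity.NavierStokesRegularity.Theorems.UnthreadedRigidity.ThreadingJets (analyticOnNhd_vortAmpL
  eq_zero_of_vortAmpL_eq_zero)

/-- the orders at a common zero: for `K`, `H` analytic near `r > 0` with `K^{m+3} = C·H^{m+1}` near `r` (`C ≠ 0`), `K = H″ + 2(m+3)H′/s` near `r`,
`K r = H r = 0` and finite orders, the order of `K·H` at `r` is `2(m+2)`. [folklore] -/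
theorem analyticOrderAt_mul_eq_of_powerLaw (m : ℕ) {K H : ℝ → ℝ} {r : ℝ} (hr : 0 < r) (hKa : AnalyticAt ℝ K r) (hHa : AnalyticAt ℝ H r)
    {C : ℝ} (hC : C ≠ 0) (hlawr : ∀ᶠ s in 𝓝 r, K s ^ (m + 3) = C * H s ^ (m + 1))
    (hKfun : ∀ᶠ s in 𝓝 r, K s = deriv (deriv H) s + 2 * ((m : ℝ) + 3) / s * deriv H s)
    (hKr : K r = 0) (hHtop : analyticOrderAt H r ≠ ⊤) (hKtop : analyticOrderAt K r ≠ ⊤) :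
    analyticOrderAt (K * H) r = (2 * (m + 2) : ℕ) := by
  obtain ⟨h, hh⟩ := ENat.ne_top_iff_exists.mp hHtop
  obtain ⟨k, hk⟩ := ENat.ne_top_iff_exists.mp hKtop
  -- `(m+3)k = (m+1)h` from the law
  have hlaw : (m + 3) * k = (m + 1) * h := by
    have e1 : analyticOrderAt (K ^ (m + 3)) r = (m + 3) • analyticOrderAt K r := analyticOrderAt_pow hKa (m + 3)
    have e2 : analyticOrderAt ((fun _ : ℝ => C) * H ^ (m + 1)) r = 0 + (m + 1) • analyticOrderAt H r := by
      rw [analyticOrderAt_mul analyticAt_const (hHa.pow (m + 1)), analyticAt_const.analyticOrderAt_eq_zero.mpr hC,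
        analyticOrderAt_pow hHa (m + 1)]
    have e3 : analyticOrderAt (K ^ (m + 3)) r = analyticOrderAt ((fun _ : ℝ => C) * H ^ (m + 1)) r := by
      apply analyticOrderAt_congr
      filter_upwards [hlawr] with s hs
      simp only [Pi.pow_apply, Pi.mul_apply]
      exact hs
    rw [e1, e2, ← hk, ← hh, zero_add] at e3
    have e4 : (((m + 3) * k : ℕ) : ℕ∞) = (((m + 1) * h : ℕ) : ℕ∞) := by
      rw [Nat.cast_mul, Nat.cast_mul]
      simpa [nsmul_eq_mul] using e3
    exact_mod_cast e4
  -- `k ≥ 1`, hence `h ≥ 2`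
  have hk1 : 1 ≤ k := by
    by_contra h0
    have hk0 : k = 0 := by omega
    rw [hk0, Nat.cast_zero] at hk
    exact ((hKa.analyticOrderAt_eq_zero).mp hk.symm) hKr
  have hh2 : 2 ≤ h := by
    by_contra h0
    have : h ≤ 1 := by omega
    have : (m + 3) * k ≤ (m + 1) * 1 := by rw [hlaw]; exact Nat.mul_le_mul_left _ this
    nlinarith
  obtain ⟨h', rfl⟩ : ∃ h', h = h' + 2 := ⟨h - 2, by omega⟩
  -- orders of `H′`, `H″`, `(2(m+3)/s)·H′`
  have hH1 : analyticOrderAt (deriv H) r = (h' + 1 : ℕ) :=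
    analyticOrderAt_deriv_of_pos hHa (by rw [← hh]; push_cast; ring)
  have hH2 : analyticOrderAt (deriv (deriv H)) r = (h' : ℕ) :=
    analyticOrderAt_deriv_of_pos hHa.deriv (by rw [hH1]; push_cast; ring)
  have hc0 : (2 * ((m : ℝ) + 3)) ≠ 0 := by positivity
  have hinv : AnalyticAt ℝ (fun s : ℝ => 2 * ((m : ℝ) + 3) / s) r := analyticAt_const.div analyticAt_id hr.ne'
  have hmix : analyticOrderAt ((fun s : ℝ => 2 * ((m : ℝ) + 3) / s) * deriv H) r = (h' + 1 : ℕ) := by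
    rw [analyticOrderAt_mul hinv hHa.deriv, hinv.analyticOrderAt_eq_zero.mpr (div_ne_zero hc0 hr.ne'), hH1, zero_add]
  have hordK : analyticOrderAt K r = (h' : ℕ) := by
    have e : analyticOrderAt K r = analyticOrderAt (deriv (deriv H) + (fun s : ℝ => 2 * ((m : ℝ) + 3) / s) * deriv H) r := by
      apply analyticOrderAt_congr
      filter_upwards [hKfun] with s hs
      simp only [Pi.add_apply, Pi.mul_apply]
      exact hs
    rw [e, analyticOrderAt_add_eq_left_of_lt (by rw [hH2, hmix]; exact_mod_cast (by omega : h' < h' + 1)), hH2]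
  rw [← hk] at hordK
  have hk2 : k = h' := by exact_mod_cast hordK
  subst hk2
  -- `(m+3)k = (m+1)(k+2)` ⇒ `k = m+1`
  have hk3 : k = m + 1 := by nlinarith
  subst hk3
  rw [analyticOrderAt_mul hKa hHa, ← hk, ← hh]
  push_cast
  ring

/-- ★ **`b_L ≡ 0` ⇒ `K·H` KEEPS A CONSTANT SIGN ON `(0,∞)`**, every degree `L = m + 2` (module docstring). [folklore] -/
theorem constant_sign_of_bL_eq_zero (m : ℕ) {H : ℝ → ℝ} (hH : VirialAdmissible (m + 2) H) (hHa : AnalyticOnNhd ℝ H (Set.Ioi 0))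
    (hb : ∀ r : ℝ, 0 < r →
      (((m + 2 : ℕ) : ℝ)) / (2 * r) * (((((m + 2 : ℕ) : ℝ)) - 1) * vortAmpL (m + 2) H r * deriv H r -
        ((((m + 2 : ℕ) : ℝ)) + 1) * deriv (vortAmpL (m + 2) H) r * H r) = 0) :
    (∀ r : ℝ, 0 < r → 0 ≤ vortAmpL (m + 2) H r * H r) ∨ (∀ r : ℝ, 0 < r → vortAmpL (m + 2) H r * H r ≤ 0) := by
  set K : ℝ → ℝ := vortAmpL (m + 2) H with hKdef
  have hK : AnalyticOnNhd ℝ K (Ioi 0) := analyticOnNhd_vortAmpL hHa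
  by_cases hHz : ∀ r : ℝ, 0 < r → H r = 0
  · exact Or.inl fun r hr => by rw [hHz r hr, mul_zero]
  push Not at hHz
  obtain ⟨r₀, hr₀, hH0⟩ := hHz
  obtain ⟨C, hKC⟩ := powerLaw m H hH hHa hb
  by_cases hC : C = 0
  · have hK0 : ∀ r : ℝ, 0 < r → K r = 0 := fun r hr => by
      have h1 := hKC r hr
      rw [hC, zero_mul] at h1
      exact (pow_eq_zero_iff (by omega)).1 h1
    exact Or.inl fun r hr => by rw [hK0 r hr, zero_mul]
  -- `C ≠ 0`: zeros coincide, no local vanishing, even orders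
  have hHloc : ∀ r : ℝ, 0 < r → analyticOrderAt H r ≠ ⊤ := by
    intro r hr htop
    exact hH0 (hHa.eqOn_zero_of_preconnected_of_eventuallyEq_zero isPreconnected_Ioi hr (analyticOrderAt_eq_top.mp htop) hr₀)
  have hKne : ∀ r : ℝ, 0 < r → H r ≠ 0 → K r ≠ 0 := by
    intro r hr hHr hKr
    have h1 := hKC r hr
    rw [show vortAmpL (m + 2) H r = K r from rfl, hKr, zero_pow (by omega)] at h1
    exact hHr ((pow_eq_zero_iff (by omega)).mp ((mul_eq_zero.mp h1.symm).resolve_left hC))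
  have hKloc : ∀ r : ℝ, 0 < r → analyticOrderAt K r ≠ ⊤ := by
    intro r hr htop
    exact hKne r₀ hr₀ hH0 (hK.eqOn_zero_of_preconnected_of_eventuallyEq_zero isPreconnected_Ioi hr (analyticOrderAt_eq_top.mp htop) hr₀)
  have hKfun : ∀ s : ℝ, K s = deriv (deriv H) s + 2 * ((m : ℝ) + 3) / s * deriv H s := fun s => by
    simp only [hKdef, vortAmpL]; push_cast; ring
  have heven : ∀ r : ℝ, 0 < r → ∃ n : ℕ, analyticOrderAt (fun s => K s * H s) r = (2 * n : ℕ) := by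
    intro r hr
    rw [show (fun s => K s * H s) = K * H from rfl]
    have hHa_r : AnalyticAt ℝ H r := hHa r hr
    have hKa_r : AnalyticAt ℝ K r := hK r hr
    by_cases hPr : K r * H r ≠ 0
    · refine ⟨0, ?_⟩
      rw [Nat.mul_zero, Nat.cast_zero, (hKa_r.mul hHa_r).analyticOrderAt_eq_zero]
      exact hPr
    · push Not at hPr
      have hHr : H r = 0 := by
        by_contra h
        exact hKne r hr h ((mul_eq_zero.mp hPr).resolve_right h)
      have hKr : K r = 0 := by
        have h1 := hKC r hr
        rw [show vortAmpL (m + 2) H r = K r from rfl, hHr, zero_pow (by omega), mul_zero] at h1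
        exact (pow_eq_zero_iff (by omega)).mp h1
      refine ⟨m + 2, analyticOrderAt_mul_eq_of_powerLaw m hr hKa_r hHa_r hC ?_ (Eventually.of_forall hKfun) hKr (hHloc r hr) (hKloc r hr)⟩
      filter_upwards [Ioi_mem_nhds hr] with s hs
      exact hKC s hs
  have hPa : AnalyticOnNhd ℝ (fun s => K s * H s) (Ioi 0) := fun r hr => (hK r hr).mul (hHa r hr)
  exact constant_sign_of_even_order hPa heven

/-- ★ **THE POWER-LAW NONEXISTENCE MODULO DECAY**, every degree `L = m + 2`: an admissible analytic profile with `b_L[H] ≡ 0` and the decay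
`|H| ≤ D·r^{−(3L+1)}` on `[1,∞)` vanishes on `(0,∞)` (sign dichotomy + the two landed branches). [folklore] -/
theorem eq_zero_of_bL_eq_zero_of_decay (m : ℕ) {H : ℝ → ℝ} (hH : VirialAdmissible (m + 2) H) (hHa : AnalyticOnNhd ℝ H (Set.Ioi 0))
    (hb : ∀ r : ℝ, 0 < r →
      (((m + 2 : ℕ) : ℝ)) / (2 * r) * (((((m + 2 : ℕ) : ℝ)) - 1) * vortAmpL (m + 2) H r * deriv H r -
        ((((m + 2 : ℕ) : ℝ)) + 1) * deriv (vortAmpL (m + 2) H) r * H r) = 0)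
    {D : ℝ} (hD0 : 0 ≤ D) (hdec : ∀ s : ℝ, 1 ≤ s → |H s| ≤ D / s ^ (3 * (m + 2) + 1)) : ∀ r : ℝ, 0 < r → H r = 0 := by
  by_contra hne
  push Not at hne
  obtain ⟨r₀, hr₀, hH0⟩ := hne
  obtain ⟨C, hKC⟩ := powerLaw m H hH hHa hb
  -- `C ≠ 0` (else `K ≡ 0 ⇒ H ≡ 0`)
  have hC : C ≠ 0 := by
    rintro rfl
    have hK0 : ∀ r : ℝ, 0 < r → vortAmpL (m + 2) H r = 0 := fun r hr => by
      have h1 := hKC r hr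
      rw [zero_mul] at h1
      exact (pow_eq_zero_iff (by omega)).1 h1
    exact hH0 (eq_zero_of_vortAmpL_eq_zero hH hK0 r₀ hr₀).1
  have hKne : ∀ r : ℝ, 0 < r → H r ≠ 0 → vortAmpL (m + 2) H r ≠ 0 := by
    intro r hr hHr hKr
    have h1 := hKC r hr
    rw [hKr, zero_pow (by omega)] at h1
    exact hHr ((pow_eq_zero_iff (by omega)).mp ((mul_eq_zero.mp h1.symm).resolve_left hC))
  rcases constant_sign_of_bL_eq_zero m hH hHa hb with hpos | hneg
  · exact hH0 (eq_zero_of_bL_eq_zero_of_nonneg (L := m + 2) (by omega) hH hHa (fun r hr => by exact_mod_cast hb r hr) hpos r₀ hr₀)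
  · exact hH0 (eq_zero_of_bL_eq_zero_of_nonpos_of_decay (L := m + 2) (by omega) hH hHa (fun r hr => by exact_mod_cast hb r hr) hneg hKne
      hD0 hdec r₀ hr₀)

end Summit.NavierStokesRegularity.NavierStokesRegularity.Theorems.UnthreadedRigidity.MixedPair

end
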